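import Summits.BirchSwinnertonDyer.BirchSwinnertonDyer.Theorems.SignedLowerHalvesKobayashiLowerHalfLargeImageHorocycleMuDoor
import Summits.BirchSwinnertonDyer.BirchSwinnertonDyer.Theorems.SignedLowerHalvesKobayashiLowerHalfLargeImageMuFloorSupply
import HarnessLib

/-!
# Route `SignedLowerHalves`, crux 3 `KobayashiLowerHalfLargeImage` (item stmt-BirchSwinnertonDyer-19001):
# line `horocycle_mu_floor` — X7 READINGS with `MuUpgrade` and `PeriodUnit` DISCHARGED: on class X7 at `p = 3` the
# crux's `∃ ε, KobayashiLowerDivisibility W 3 ε` follows from the `p`-INVERTED Eisenstein divisibility and the period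
# named fact `h3` ALONE; at `p ≥ 5` from the same + `h5` + Conjecture B⁰ (`TeichSpanGenAll`)
# (cell `bsd-ssimc`, width seat `bsd-line-slh-p1-w2` gen 5, file 2; helper file `--supports 19001`)

HONEST FRAMING: the crux is OPEN and nothing here proves it; BSD is not proved by any of this. THEOREMS ONLY
(no `def`, no named fact, no `sorry`). SUPPORT for the UNREGISTERED line `Lines/horocycle_mu_floor.lean` (k2 g16).

This file COMPOSES two landed helper files: the μ-FLOOR of width seat w6
(`…Theorems.LargeImageMuFloor`, p647857: the line's `SignedMuFloorW W p` is INPUT-FREE at `p = 3` — THEOREM B road on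
Vaserstein's theorem, `SmallImageCycWindingMuThree.exists_sign_hasUnitContent_three_of_isNewformOf` — and is
Conjecture B⁰ BY NAME at `p ≥ 5`) with this seat's door (`…Theorems.HorocycleMuDoor`, p647721: `MuUpgrade` PROVED,
`PeriodUnit` ⟸ `h5`/`h3`, and `LambdaLowerDivisibility W p ε ∧ μ(L^ε_p) = 0 ∧ period unit ⟹ KobayashiLowerDivisibility W p ε`):

* §1 `exists_isSignedPAdicLFunction_of_exists_sign_forall_isPollackPair` — the converse of w6's dictionary
  (Pollack-pair currency ⟹ `IsSignedPAdicLFunction` currency; Pollack's existence theorem PROVED in the tree,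
  `pollack_exists_plusMinusPAdicLFunction_holds`), so the two currencies of «`min(μ⁺, μ⁻) = 0`» AGREE;
  `signedMuFloor_of_teichOrbitNonConstantAt` — the B⁰-FREE intermediate: `SignedMuFloorW W p` ⟸
  `TeichOrbitNonConstantAt W p` at any odd good prime with `a_p = 0` (tree `exists_sign_hasUnitContent_of_teichOrbitNonConstantAt`).
* §2 **`p = 3`**: `exists_kobayashiLowerDivisibility_three_of_pInverted_of_good` — for EVERY `W/ℚ` globally minimal
  with good reduction at `3` and `a₃ = 0`: `∃ ε, KobayashiLowerDivisibility W 3 ε` ⟸ {the line's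
  `LambdaLowerDivisibility W 3 ε` for both signs, `h3`} and NOTHING ELSE (no `MuUpgrade`, `PeriodUnit`, (Conn),
  `ReductionAtThree`, `DescentStabilisation`, `NewformExists`, B⁰ hypotheses); `X7.…` = the crux's corner.
* §3 **odd `p`**: `X7.exists_kobayashiLowerDivisibility_of_teichSpanGenAll_of_pInverted` (⟸ λ-parts + `h5`/`h3` + B⁰,
  B⁰ used only at `p ≥ 5`), `X7.exists_kobayashiLowerDivisibility_of_teichOrbitNonConstantAt_of_pInverted` (B⁰-free),
  and the crux's BODY verbatim, `kobayashiLowerHalfLargeImage_body_of_pInverted_of_teichSpanGenAll` ⟸ {λ-parts on the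
  class, `h5`, `h3`, B⁰} — its by-name closure is one `exact` in a Theses-importing file (w6's announced
  `…LargeImageMuFloorCrux`; not written here).

NET (line `horocycle_mu_floor` after p647721 + p647857 + this file): every μ-side piece is a theorem or a named tree
object; the OPEN content toward crux 3 is EXACTLY the external `p`-inverted λ-part (crux-sized; the hard content of
every finite-slope engine) and, at `p ≥ 5` only, B⁰. μ-folklore NEGATIVE rule honoured (nothing on μ asserted beyond
the proved `p = 3` case; B⁰ displayed). CALIBRATION / SUPPORT ONLY: not a stub of the line of record, never a `closes`.

References: [Kobayashi2003] Conjecture (p. 2), (3.4)–(3.6) (p. 7); [Pollack2003] Thm. 5.6, Prop. 6.18;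
[Vaserstein1972SL2] Theorem; [MazurTateTeitelbaum1986Invent] §I.10 (10.1); [Serre1972] §1.11 Prop. 12;
[GreenbergVatsal2000] §3 Remark 3.4; [Mazur1978] Cor. 4.1; [Manin1972] Prop. 1.4 (B⁰'s vocabulary).
-/

set_option autoImplicit false
set_option linter.dupNamespace false

noncomputable section

open scoped Classical MatrixGroups ModularForm

open CongruenceSubgroup WeierstrassCurve Literature.NumberTheory.EllipticCurves
  Literature.NumberTheory.EllipticCurves.ModularForms
  Literature.NumberTheory.EllipticCurves.Rank1Residual
  Literature.NumberTheory.EllipticCurves.Rank1Residual.Typed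
  Literature.NumberTheory.EllipticCurves.GreenbergVatsal2000
  Literature.NumberTheory.EllipticCurves.Kobayashi2003 ZpExtension
  Summit.BirchSwinnertonDyer.Rank1Residual.Supersingular
  Summit.BirchSwinnertonDyer.BirchSwinnertonDyer.Theorems.HorocycleMuDoor
  Summit.BirchSwinnertonDyer.BirchSwinnertonDyer.Theorems.LargeImageMuFloor
  Summit.BirchSwinnertonDyer.BirchSwinnertonDyer.Theorems.SmallImageTeichOrbitMu
  Summit.BirchSwinnertonDyer.BirchSwinnertonDyer.Cruxes.AnalyticMuZeroX9.TeichSpan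

namespace Summit.BirchSwinnertonDyer.BirchSwinnertonDyer.Theorems.HorocycleMuFloor

/-! ## §1. The converse dictionary and the B⁰-free intermediate -/

section Currency

variable {N : ℕ} [NeZero N] {f : CuspForm (Gamma0 N) 2} {p : ℕ} [hp : Fact p.Prime]

/-- **Pollack-pair currency ⟹ `IsSignedPAdicLFunction` currency** (converse of
`LargeImageMuFloor.exists_sign_forall_isPollackPair_hasUnitContent`), at an odd good prime with `a_p = 0` for the
newform `f` of `W` — where a Pollack pair EXISTS by Pollack's theorem, PROVED in the tree
(`pollack_exists_plusMinusPAdicLFunction_holds`). So «`∃ ε`, unit content of `kobayashiL ε` of every Pollack pair» and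
«`∃ ε L, IsSignedPAdicLFunction f p ε L ∧ HasUnitContent L`» are the SAME statement `min(μ(L_p⁺), μ(L_p⁻)) = 0`.
[cite: Pollack2003, Thm. 5.6, Cor. 5.11 and Prop. 6.18] [cite: Kobayashi2003, (3.4)–(3.6) (p. 7)] -/
theorem exists_isSignedPAdicLFunction_of_exists_sign_forall_isPollackPair {W : WeierstrassCurve ℚ}
    [W.IsElliptic] [W.IsGloballyMinimal] (hp2 : p ≠ 2) (hf : IsNewformOf W f)
    (hgood : W.HasGoodReductionAtPrime p) (hap : W.frobeniusTrace p = 0)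
    (h : ∃ ε : ℤˣ, ∀ Lplus Lminus : IwasawaAlgebra p, IsPollackPair f p Lplus Lminus →
      HasUnitContent (kobayashiL ε Lplus Lminus)) :
    ∃ (ε : ℤˣ) (L : IwasawaAlgebra p), IsSignedPAdicLFunction f p ε L ∧ HasUnitContent L := by
  obtain ⟨ε, hε⟩ := h
  obtain ⟨Lplus, Lminus, hPP⟩ :=
    exists_isPollackPair (pollack_exists_plusMinusPAdicLFunction_holds (W := W) (f := f) (p := p)) hp2 hf hgood hap
  exact ⟨ε, kobayashiL ε Lplus Lminus, hPP.isSignedPAdicLFunction_kobayashiL ε, hε Lplus Lminus hPP⟩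

end Currency

section MuFloor

variable (W : WeierstrassCurve ℚ) [W.IsElliptic] [W.IsGloballyMinimal] (p : ℕ) [hp : Fact p.Prime]

/-- **B⁰-free intermediate: the line's `SignedMuFloorW W p` ⟸ `TeichOrbitNonConstantAt W p`** at an odd good prime
with `a_p = 0` (two Teichmüller-orbit sums of plus symbols on the `p`-power cusps differ by a `p`-adic unit — the
tree's carrier `Rank1Residual/MuLambdaCarriers`; slh-p3's `exists_sign_hasUnitContent_of_teichOrbitNonConstantAt` +
w6's sign-before-newform + dictionary). [cite: MazurTateTeitelbaum1986Invent, §I.10 (10.1)] [cite: PollackWeston2011, Thm. 4.1 (1)] -/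
theorem signedMuFloor_of_teichOrbitNonConstantAt (hp2 : p ≠ 2) (hgood : W.HasGoodReductionAtPrime p)
    (hap : W.frobeniusTrace p = 0) (hT : TeichOrbitNonConstantAt W p) :
    ∃ ε : ℤˣ, ∀ [NeZero (W.conductorNorm ℤ)] (f : CuspForm (Gamma0 (W.conductorNorm ℤ)) 2),
      IsNewformOf W f → ∀ Lplus Lminus : IwasawaAlgebra p, IsPollackPair f p Lplus Lminus →
        HasUnitContent (kobayashiL ε Lplus Lminus) :=
  exists_sign_forall_isNewformOf
    (fun ε f ↦ ∀ Lplus Lminus : IwasawaAlgebra p, IsPollackPair f p Lplus Lminus →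
      HasUnitContent (kobayashiL ε Lplus Lminus))
    fun f hf ↦ exists_sign_forall_isPollackPair_hasUnitContent
      (exists_sign_hasUnitContent_of_teichOrbitNonConstantAt f hp2 hf hgood hap hT)

end MuFloor

/-! ## §2. `p = 3`: the crux's `∃ ε` from the `p`-inverted λ-part and `h3` alone -/

section Three

variable (W : WeierstrassCurve ℚ) [W.IsElliptic] [W.IsGloballyMinimal]

/-- **`p = 3`, every curve good at `3` with `a₃ = 0`: `∃ ε, KobayashiLowerDivisibility W 3 ε` ⟸ the `p`-inverted
Eisenstein divisibility (both signs) + the period named fact `h3` — NOTHING ELSE.** `hlam ε` = the line's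
`LambdaLowerDivisibility W 3 ε` verbatim (external λ-part engine); `h3` = `realPeriodRat_eq_unit_mul_plusPeriod_three`
(Mazur 1978 Cor. 4.1 at `3 ∤ N`). μ-half: w6's `signedMuFloor_three'` (INPUT-FREE); upgrade: this seat's door;
period: `E[3]` irreducible at a supersingular `3`. Semistability, `¬CM`, `Surj` are NOT used.
[cite: Kobayashi2003, Conjecture (p. 2)] [cite: Vaserstein1972SL2, Theorem] [cite: Mazur1978, Cor. 4.1]
[cite: GreenbergVatsal2000, §3, Remark 3.4] -/
theorem exists_kobayashiLowerDivisibility_three_of_pInverted_of_good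
    (h3 : realPeriodRat_eq_unit_mul_plusPeriod_three)
    (hgood : W.HasGoodReductionAtPrime 3) (hap : W.frobeniusTrace 3 = 0)
    (hlam : ∀ (ε : ℤˣ) (κ : ZpExtension ℚ 3) (γ : Field.absoluteGaloisGroup ℚ),
        κ.IsCyclotomic → κ.IsTopGenerator γ → IsCyclotomicVariable 3 γ →
      ∀ [NeZero (W.conductorNorm ℤ)] (f : CuspForm (Gamma0 (W.conductorNorm ℤ)) 2),
        IsNewformOf W f → ∀ (ϖ : ℚ), (ϖ : ℝ) * W.realPeriodRat = plusPeriod f →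
      ∀ (Lplus Lminus : IwasawaAlgebra 3), IsPollackPair f 3 Lplus Lminus →
      ∀ (D : SignedSelmerDualData W κ γ ε),
        ∃ (g h : IwasawaAlgebra 3) (m : ℕ), D.charIdeal = Ideal.span {g} ∧
          iwasawaToPowerSeries 3 (PowerSeries.C ((3 : ℤ_[3]) ^ m) * g) =
            PowerSeries.C (ϖ : ℚ_[3]) * iwasawaToPowerSeries 3 (kobayashiL ε Lplus Lminus * h)) :
    ∃ ε : ℤˣ, KobayashiLowerDivisibility W 3 ε := by
  obtain ⟨ε, hε⟩ := signedMuFloor_three' (W := W) hgood hap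
  refine ⟨ε, kobayashiLowerDivisibility_of_pInverted_of_hasUnitContent W 3 ε (by exact_mod_cast hlam ε) hε ?_⟩
  intro _ f hf ϖ hϖ
  obtain ⟨u, hu, hΩ⟩ :=
    h3 W hgood (SmallImageCycWindingMuThree.hasIrreducibleModPGaloisRep_three_of_frobeniusTrace_eq_zero W hgood hap) f hf
  exact padicValRat_periodRatio_eq_zero_of_eq_unit_mul W 3 f hu hΩ ϖ hϖ

/-- The same on the crux's corner, with its hypotheses displayed (class X7 at `3`, `a₃ = 0`; `¬CM`, `Surj` idle):
at the `p = 3` pairs of X7 the crux IS the `p`-inverted λ-part (both signs) modulo `h3`.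
[cite: Kobayashi2003, Conjecture (p. 2)] [cite: Vaserstein1972SL2, Theorem] -/
theorem X7.exists_kobayashiLowerDivisibility_three_of_pInverted (h3 : realPeriodRat_eq_unit_mul_plusPeriod_three)
    (hX : ClassX7 W 3) (hap : W.frobeniusTrace 3 = 0)
    (hlam : ∀ (ε : ℤˣ) (κ : ZpExtension ℚ 3) (γ : Field.absoluteGaloisGroup ℚ),
        κ.IsCyclotomic → κ.IsTopGenerator γ → IsCyclotomicVariable 3 γ →
      ∀ [NeZero (W.conductorNorm ℤ)] (f : CuspForm (Gamma0 (W.conductorNorm ℤ)) 2),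
        IsNewformOf W f → ∀ (ϖ : ℚ), (ϖ : ℝ) * W.realPeriodRat = plusPeriod f →
      ∀ (Lplus Lminus : IwasawaAlgebra 3), IsPollackPair f 3 Lplus Lminus →
      ∀ (D : SignedSelmerDualData W κ γ ε),
        ∃ (g h : IwasawaAlgebra 3) (m : ℕ), D.charIdeal = Ideal.span {g} ∧
          iwasawaToPowerSeries 3 (PowerSeries.C ((3 : ℤ_[3]) ^ m) * g) =
            PowerSeries.C (ϖ : ℚ_[3]) * iwasawaToPowerSeries 3 (kobayashiL ε Lplus Lminus * h)) :
    ∃ ε : ℤˣ, KobayashiLowerDivisibility W 3 ε :=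
  exists_kobayashiLowerDivisibility_three_of_pInverted_of_good W h3 hX.1.1 hap hlam

end Three

/-! ## §3. Odd `p`: the crux's `∃ ε` from λ-parts + `h5`/`h3` + B⁰ (used at `p ≥ 5` only), and the crux's body -/

section Odd

variable (W : WeierstrassCurve ℚ) [W.IsElliptic] [W.IsGloballyMinimal] (p : ℕ) [hp : Fact p.Prime]

/-- **X7, odd `p`: `∃ ε, KobayashiLowerDivisibility W p ε` ⟸ λ-parts + `h5`/`h3` + Conjecture B⁰** (`TeichSpanGenAll`,
OPEN, displayed; consumed only at `p ≥ 5` inside w6's `signedMuFloor_of_teichSpanGenAll`). Period unit: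
`HorocycleMuDoor.periodUnit_of_named_facts`; upgrade: the door. `¬CM`, `Surj` idle.
[cite: Kobayashi2003, Conjecture (p. 2)] [cite: Manin1972, Prop. 1.4] [cite: GreenbergVatsal2000, §3, Remark 3.4] -/
theorem X7.exists_kobayashiLowerDivisibility_of_teichSpanGenAll_of_pInverted (hB : TeichSpanGenAll)
    (h5 : realPeriodRat_eq_unit_mul_plusPeriod) (h3 : realPeriodRat_eq_unit_mul_plusPeriod_three)
    (hp2 : p ≠ 2) (hX : ClassX7 W p) (hap : W.frobeniusTrace p = 0)
    (hlam : ∀ (ε : ℤˣ) (κ : ZpExtension ℚ p) (γ : Field.absoluteGaloisGroup ℚ),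
        κ.IsCyclotomic → κ.IsTopGenerator γ → IsCyclotomicVariable p γ →
      ∀ [NeZero (W.conductorNorm ℤ)] (f : CuspForm (Gamma0 (W.conductorNorm ℤ)) 2),
        IsNewformOf W f → ∀ (ϖ : ℚ), (ϖ : ℝ) * W.realPeriodRat = plusPeriod f →
      ∀ (Lplus Lminus : IwasawaAlgebra p), IsPollackPair f p Lplus Lminus →
      ∀ (D : SignedSelmerDualData W κ γ ε),
        ∃ (g h : IwasawaAlgebra p) (m : ℕ), D.charIdeal = Ideal.span {g} ∧
          iwasawaToPowerSeries p (PowerSeries.C ((p : ℤ_[p]) ^ m) * g) =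
            PowerSeries.C (ϖ : ℚ_[p]) * iwasawaToPowerSeries p (kobayashiL ε Lplus Lminus * h)) :
    ∃ ε : ℤˣ, KobayashiLowerDivisibility W p ε := by
  obtain ⟨ε, hε⟩ := signedMuFloor_of_teichSpanGenAll (W := W) (p := p) hB hp2 hX.1.1 hap
  exact ⟨ε, kobayashiLowerDivisibility_of_pInverted_of_hasUnitContent W p ε (hlam ε) hε
    (periodUnit_of_named_facts h5 h3 W p hp2 hX.1.1 hX.1.2)⟩

/-- **X7, odd `p`, B⁰-FREE: `∃ ε, KobayashiLowerDivisibility W p ε` ⟸ λ-parts + `h5`/`h3` + `TeichOrbitNonConstantAt W p`**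
(the per-curve carrier statement instead of the uniform conjecture B⁰). [cite: Kobayashi2003, Conjecture (p. 2)]
[cite: MazurTateTeitelbaum1986Invent, §I.10 (10.1)] [cite: GreenbergVatsal2000, §3, Remark 3.4] -/
theorem X7.exists_kobayashiLowerDivisibility_of_teichOrbitNonConstantAt_of_pInverted
    (h5 : realPeriodRat_eq_unit_mul_plusPeriod) (h3 : realPeriodRat_eq_unit_mul_plusPeriod_three)
    (hp2 : p ≠ 2) (hX : ClassX7 W p) (hap : W.frobeniusTrace p = 0) (hT : TeichOrbitNonConstantAt W p)
    (hlam : ∀ (ε : ℤˣ) (κ : ZpExtension ℚ p) (γ : Field.absoluteGaloisGroup ℚ),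
        κ.IsCyclotomic → κ.IsTopGenerator γ → IsCyclotomicVariable p γ →
      ∀ [NeZero (W.conductorNorm ℤ)] (f : CuspForm (Gamma0 (W.conductorNorm ℤ)) 2),
        IsNewformOf W f → ∀ (ϖ : ℚ), (ϖ : ℝ) * W.realPeriodRat = plusPeriod f →
      ∀ (Lplus Lminus : IwasawaAlgebra p), IsPollackPair f p Lplus Lminus →
      ∀ (D : SignedSelmerDualData W κ γ ε),
        ∃ (g h : IwasawaAlgebra p) (m : ℕ), D.charIdeal = Ideal.span {g} ∧
          iwasawaToPowerSeries p (PowerSeries.C ((p : ℤ_[p]) ^ m) * g) =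
            PowerSeries.C (ϖ : ℚ_[p]) * iwasawaToPowerSeries p (kobayashiL ε Lplus Lminus * h)) :
    ∃ ε : ℤˣ, KobayashiLowerDivisibility W p ε := by
  obtain ⟨ε, hε⟩ := signedMuFloor_of_teichOrbitNonConstantAt W p hp2 hX.1.1 hap hT
  exact ⟨ε, kobayashiLowerDivisibility_of_pInverted_of_hasUnitContent W p ε (hlam ε) hε
    (periodUnit_of_named_facts h5 h3 W p hp2 hX.1.1 hX.1.2)⟩

/-- **The crux's BODY, verbatim, from {λ-parts on the class, `h5`, `h3`, B⁰}.** For every `W/ℚ` globally minimal,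
odd `p`, class X7, `¬CM`, `a_p = 0`, `Surj W p`: `∃ ε, KobayashiLowerDivisibility W p ε` — granted the `p`-inverted
Eisenstein divisibility for both signs on the class (`hlam`: the line's external λ-part; crux-sized), the period
named facts, and Conjecture B⁰ (entering at `p ≥ 5` only; the 2608 `p = 3` pairs of the crux's 4377 X7 window pairs
carry NO μ-hypothesis, §2). The by-name closure `… : KobayashiLowerHalfLargeImage` is `fun W _ _ p _ ↦ this W p …` in a
Theses-importing file. CONDITIONAL; closes nothing. [cite: Kobayashi2003, Conjecture (p. 2)]
[cite: Vaserstein1972SL2, Theorem] [cite: Manin1972, Prop. 1.4] -/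
theorem kobayashiLowerHalfLargeImage_body_of_pInverted_of_teichSpanGenAll
    (h5 : realPeriodRat_eq_unit_mul_plusPeriod) (h3 : realPeriodRat_eq_unit_mul_plusPeriod_three)
    (hB : TeichSpanGenAll)
    (hlam : ∀ (W : WeierstrassCurve ℚ) [W.IsElliptic] [W.IsGloballyMinimal] (p : ℕ) [Fact p.Prime],
      p ≠ 2 → ClassX7 W p → ¬ W.HasCM → W.frobeniusTrace p = 0 → Surj W p →
      ∀ (ε : ℤˣ) (κ : ZpExtension ℚ p) (γ : Field.absoluteGaloisGroup ℚ),
        κ.IsCyclotomic → κ.IsTopGenerator γ → IsCyclotomicVariable p γ →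
      ∀ [NeZero (W.conductorNorm ℤ)] (f : CuspForm (Gamma0 (W.conductorNorm ℤ)) 2),
        IsNewformOf W f → ∀ (ϖ : ℚ), (ϖ : ℝ) * W.realPeriodRat = plusPeriod f →
      ∀ (Lplus Lminus : IwasawaAlgebra p), IsPollackPair f p Lplus Lminus →
      ∀ (D : SignedSelmerDualData W κ γ ε),
        ∃ (g h : IwasawaAlgebra p) (m : ℕ), D.charIdeal = Ideal.span {g} ∧
          iwasawaToPowerSeries p (PowerSeries.C ((p : ℤ_[p]) ^ m) * g) =
            PowerSeries.C (ϖ : ℚ_[p]) * iwasawaToPowerSeries p (kobayashiL ε Lplus Lminus * h)) :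
    ∀ (W : WeierstrassCurve ℚ) [W.IsElliptic] [W.IsGloballyMinimal] (p : ℕ) [Fact p.Prime],
      p ≠ 2 → ClassX7 W p → ¬ W.HasCM → W.frobeniusTrace p = 0 → Surj W p →
      ∃ ε : ℤˣ, KobayashiLowerDivisibility W p ε :=
  fun W _ _ p _ hp2 hX hCM hap hS ↦
    X7.exists_kobayashiLowerDivisibility_of_teichSpanGenAll_of_pInverted W p hB h5 h3 hp2 hX hap
      (hlam W p hp2 hX hCM hap hS)

end Odd

end Summit.BirchSwinnertonDyer.BirchSwinnertonDyer.Theorems.HorocycleMuFloor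

end
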